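import Summits.QuantumFields.BalabanUV.Beta.GAN24.ExponentialChartBaseHessianMoments

/-!
# `BalabanUV.Beta.GAN24.ExponentialChartBaseHessianMomentsEnd` — binder row G-an2-4 ∕ (CONV-C), route R7 «TWO CURRENCIES», PART 273: THE β-TYPE NUMBERS OF THE ONE-LOOP HESSIAN AT
# A NONZERO SMALL ABELIAN BACKGROUND ADD IN THE DIRECTIONS, DISPLAYING ONLY `(α, β)` + EL₁ OF THE DIRECTIONS AND THE BASE CONNECTION'S CONSTANTS ∕ EL₁ ON THE DISC (PART 260 at the
# base point `U₀ = e^{iηA₀}`).  PART 272 proved, for ANY infinite-volume limit kernels of PART 269's families of `(A₁, B)`, `(A₂, B)`, `(A₁ + A₂, B)` at `U₀`, additivity of the (1.22)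
# second moments at every level under (UD) and at the limit under the END's rates, under the invertibility at the base; PART 269's END supplies the kernels, (UD) at `κ∕d > 0` and
# the rate at `θ = √(L⁻¹) < 1`, and PART 271 §0 the invertibility — so the corollary displays only `(α, β)` + EL₁ of `A₁, A₂, B`, `(α₀, β₀) ∕ (α₀′, β₀′)` + EL₁ of `connV U₀,t ∕
# zT U₀,t` and the three-condition disc at coupling `1` (the sum direction is Lipschitz `(2α, 2β)` by PART 253's `lipschitzBackground_add`, `B` is re-read at `(2α, 2β)` by
# `lipschitzBackground_mono`; the disc conditions do not involve the directions' constants) (unit b2b-balaban-gan24-p3, gen 67; v1; generator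
# `HOME/b2b-balaban-gan24-p3/gen67/records/gen/gen273.py`)

NOT IN PRINT; OUR PROOF ([folklore] bookkeeping BY NAME over PART 272 (`hessianAtMoments_add_left ∕ _add_right`), PART 269 (`conv_deriv_deriv_invCov_expChartAt₂_of_tendsto`), PART
271 §0 (`isUnit_det_calDalev_add_covPert_of_disc`, `isUnit_det_avgTow_pertInv_of_disc`), PART 253 (`lipschitzBackground_add ∕ _mono`), Mathlib's `Real.sqrt_lt_sqrt`,
`Complex.ofReal_add`; [Balaban1985BackgroundPropagators] (3.3) p. 390 and [Balaban1987RG1] (1.20)–(1.22) p. 264 LOCATE the shapes; nothing printed is a hypothesis).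
HONEST FRAMING (cell contract, verbatim): «discharging `BetaPertH` makes Bałaban's UV stability UNCONDITIONAL — a real constructive-QFT result; it is NOT the
continuum limit and NOT the Clay problem.»  HONEST DEPENDENCY (verbatim): «continuum YM on T⁴ ⇐ BetaPertH ∧ nine spine estimates (0/9 proved); BetaPertH ⇐
(D1) ∧ (D4) ∧ CAP+tail; G-an2-4 gates asym, D1 and NE2/3/4.»

WHAT THIS FILE PROVES (0 sorry, 0 `def`; `d ≥ 3`, `L ≥ 2`, `a > 0`, `μ ≠ ν`, even cubic volumes `2(t+1)`, REAL `A₀` and directions):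
* **`exists_hessianAtMoments_add_left_of_tendsto`**: limit kernels `Π₁, Π₂, Π₁₂` of PART 269's families of `(A₁, B)`, `(A₂, B)`, `(A₁ + A₂, B)` at `U₀` with
  `Σ_xΠ₁₂,_k x_μx_ν = Σ_xΠ₁,_k x_μx_ν + Σ_xΠ₂,_k x_μx_ν` at every level `k` AND for the telescoped limit kernels; `exists_hessianAtMoments_add_right_of_tendsto` (second direction).
WHAT IT DOES NOT DO: the other laws at the END (symmetry ∕ homogeneity need no analytic input — PART 272 as stated); the diagonal; colour; Bałaban's `−∂P∂*` ∕ `aQ(U)*Q(U)` parts;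
base points off the disc.  SUPPLIER work; NEVER «G-an2-4 closed»; NOT (CONV-C), NOT D1, NOT `BetaPertH`, NOT continuum, NOT Clay.  Records: `HOME/b2b-balaban-gan24-p3/gen67/README.md`.
-/

noncomputable section

open scoped BigOperators ComplexConjugate Matrix Matrix.Norms.L2Operator
open Filter Topology

namespace Summit.QuantumFields.BalabanUV.Beta.GAN24.ExponentialChartBaseHessianMomentsEnd

open Literature.MathematicalPhysics.QuantumFieldTheory.Balaban1983to89
open Literature.MathematicalPhysics.QuantumFieldTheory.Balaban1983to89.B5Prop11Plancherel (Tor fine Cst)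
open Literature.MathematicalPhysics.QuantumFieldTheory.Balaban1983to89.B5G183RateUnitTower (lev)
open Literature.MathematicalPhysics.QuantumFieldTheory.Balaban1983to89.Beta (Site IsInfiniteVolumeLimit)
open Literature.MathematicalPhysics.QuantumFieldTheory.Balaban1983to89.Beta.FreeLegDictionary (cubic)
open Literature.MathematicalPhysics.QuantumFieldTheory.Balaban1983to89.Beta.BlockKernelVolumeSockets (evenPeriod)
open Literature.MathematicalPhysics.QuantumFieldTheory.Balaban1983to89.Beta.VectorTails (castT)
open Literature.MathematicalPhysics.QuantumFieldTheory.Balaban1983to89.Beta.LimitRate (limKernelOf)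
open Summit.QuantumFields.BalabanUV.T4Continuum
open Summit.QuantumFields.BalabanUV.T4Continuum.CovariantAveragingTower (avgTow)
open Summit.QuantumFields.BalabanUV.T4Continuum.BalabanAveragedTowerUnit (idx QBlev)
open Summit.QuantumFields.BalabanUV.T4Continuum.BalabanAveragedCoerciveTower (unitIdx)
open Summit.QuantumFields.BalabanUV.T4Continuum.BalabanAveragedCoercive (gammaB)
open Summit.QuantumFields.BalabanUV.T4Continuum.KingPairingPlantedLaw (calDalev)
open Summit.QuantumFields.BalabanUV.T4Continuum.FirstOrderBackgroundModel (LipschitzBackground)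
open Summit.QuantumFields.BalabanUV.T4Continuum.PerturbationAlgebra (BoundedBackground)
open Summit.QuantumFields.BalabanUV.T4Continuum.AbelianCovariantLaplacian (covPert connV zT)
open Summit.QuantumFields.BalabanUV.T4Continuum.CTConjugatedHbd (G2)
open Summit.QuantumFields.BalabanUV.T4Continuum.DirichletRegionTower (gamD)
open Summit.QuantumFields.BalabanUV.T4Continuum.ScalarAveragedPropagator (gammaPs)
open Summit.QuantumFields.BalabanUV.T4Continuum.ScalarAveragedCompression (sigma0)
open Summit.QuantumFields.BalabanUV.T4Continuum.CTScalarGreen (Jfree)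
open Summit.QuantumFields.BalabanUV.T4Continuum.CTGaugeTerm (deltaK)
open Summit.QuantumFields.BalabanUV.T4Continuum.CTVectorPropagator (JA)
open Summit.QuantumFields.BalabanUV.Beta.GAN24.ExponentialChartMixedBackgrounds (lipschitzBackground_add lipschitzBackground_mono)
open Summit.QuantumFields.BalabanUV.Beta.GAN24.ExponentialChartBaseCovariantTaylorEnd (conv_deriv_deriv_invCov_expChartAt₂_of_tendsto)
open Summit.QuantumFields.BalabanUV.Beta.GAN24.ExponentialChartBaseHessianKernels (isUnit_det_calDalev_add_covPert_of_disc isUnit_det_avgTow_pertInv_of_disc)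
open Summit.QuantumFields.BalabanUV.Beta.GAN24.ExponentialChartBaseHessianMoments (hessianAtMoments_add_left hessianAtMoments_add_right)

/-! ## §1 OVER PART 269's END: additivity of the β-type numbers at `U₀` in either direction -/

section End

variable {d : ℕ} (L : ℕ) [NeZero L] (a : ℝ) (ha : 0 < a)

/-- **`exists_hessianAtMoments_add_left_of_tendsto` — THE β-TYPE NUMBERS OF THE ONE-LOOP HESSIAN AT `U₀` ADD IN THE FIRST DIRECTION, DISPLAYING ONLY `(α, β)` + EL₁ AND THE BASE
CONSTANTS ON THE DISC** [our proof] (`d ≥ 3`, `L ≥ 2`, `a > 0`, `μ ≠ ν`, even cubic volumes): for volume-indexed REAL directions `A₁, A₂, B`, each `LipschitzBackground (α, β)`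
uniformly in `t`, with pointwise limits at the fine integer readings, and a REAL base family `A₀` whose connection `connV U₀,t` is Lipschitz `(α₀, β₀)` with EL₁ and whose `zT U₀,t` is
bounded `(α₀′, β₀′)` with EL₁, on PART 264's three-condition disc at coupling `1`: PART 269 supplies limit kernels `Π₁, Π₂, Π₁₂` of the families of `(A₁, B)`, `(A₂, B)`,
`(A₁ + A₂, B)` (the last two at `(2α, 2β)`) with (UD) at `κ₁∕d > 0` and the rate at `θ = √(L⁻¹) < 1`, PART 271 §0 the invertibility at the base; PART 272 then gives additivity at
every level AND at the limit. [cite: Balaban1985BackgroundPropagators, (3.3) p.390 (shapes); Balaban1987RG1, (1.20)–(1.22) p.264 (shapes)] -/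
theorem exists_hessianAtMoments_add_left_of_tendsto (hL : 2 ≤ L) (hd : 3 ≤ d) {μ ν : Fin d} (hne : μ ≠ ν) {α β α₀ β₀ α₀' β₀' a' κ : ℝ}
    (ha' : 0 < a') (hκ0 : 0 < κ)
    (hγ' : Jfree d a' κ 1 < gammaPs d a') (hδ' : deltaK d a' κ 1 < sigma0 d a' ^ 2) (hJA : JA d a a' κ 1 < gamD d a)
    (hT₁ : 1 * (2 * (d * (α₀ + β₀) * Cst d a) + α₀' * Cst d a) ≤ 1 / 2)
    (hT₂ : 1 * (d * (α₀ * G2 d a (max (JA d a a' κ 1) 0) (gamD d a - max (JA d a a' κ 1) 0) κ)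
      + d * (Real.exp |κ| * (α₀ * G2 d a (max (JA d a a' κ 1) 0) (gamD d a - max (JA d a a' κ 1) 0) κ + β₀ * (gamD d a - max (JA d a a' κ 1) 0)⁻¹))
      + α₀' * (gamD d a - max (JA d a a' κ 1) 0)⁻¹) ≤ 1 / 2)
    (hT₃ : 4 * 1 * (2 * (d * (α₀ + β₀) * Cst d a) + α₀' * Cst d a) * Cst d a ≤ gammaB d a)
    {A₀ A₁ A₂ B : (t : ℕ) → (k : ℕ) → Fin d → (idx L (cubic d (evenPeriod t)) k → ℝ)}
    (hA₁ : ∀ t, LipschitzBackground L (cubic d (evenPeriod t)) (fun k ν' x => (A₁ t k ν' x : ℂ)) α β)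
    (hA₂ : ∀ t, LipschitzBackground L (cubic d (evenPeriod t)) (fun k ν' x => (A₂ t k ν' x : ℂ)) α β)
    (hB : ∀ t, LipschitzBackground L (cubic d (evenPeriod t)) (fun k ν' x => (B t k ν' x : ℂ)) α β)
    (hw : ∀ t, LipschitzBackground L (cubic d (evenPeriod t)) (connV L (cubic d (evenPeriod t)) (fun k'' ν' (x' : idx L (cubic d (evenPeriod t)) k'') => Complex.exp (Complex.I * ((A₀ t) k''
          ν' x' : ℂ) / ((lev L k'' : ℕ) : ℂ)))) α₀ β₀)
    (hz : ∀ t, BoundedBackground L (cubic d (evenPeriod t)) (zT L (cubic d (evenPeriod t)) (fun k'' ν' (x' : idx L (cubic d (evenPeriod t)) k'') => Complex.exp (Complex.I * ((A₀ t) k'' ν'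
          x' : ℂ) / ((lev L k'' : ℕ) : ℂ)))) α₀' β₀')
    (hA₁1 : ∀ k (ν' f : Fin d) (z : Fin d → ℤ), ∃ s' : ℂ, Tendsto (fun t => ((A₁ t k ν' (castT (cubic d (lev L k * evenPeriod t)) z, f) : ℝ) : ℂ)) atTop (𝓝 s'))
    (hA₂1 : ∀ k (ν' f : Fin d) (z : Fin d → ℤ), ∃ s' : ℂ, Tendsto (fun t => ((A₂ t k ν' (castT (cubic d (lev L k * evenPeriod t)) z, f) : ℝ) : ℂ)) atTop (𝓝 s'))
    (hB1 : ∀ k (ν' f : Fin d) (z : Fin d → ℤ), ∃ s' : ℂ, Tendsto (fun t => ((B t k ν' (castT (cubic d (lev L k * evenPeriod t)) z, f) : ℝ) : ℂ)) atTop (𝓝 s'))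
    (hw1 : ∀ k (ν' f : Fin d) (z : Fin d → ℤ), ∃ s' : ℂ, Tendsto (fun t => connV L (cubic d (evenPeriod t)) (fun k'' ν' (x' : idx L (cubic d (evenPeriod t)) k'') => Complex.exp (Complex.I *
          ((A₀ t) k'' ν' x' : ℂ) / ((lev L k'' : ℕ) : ℂ))) k ν' (castT (cubic d (lev L k * evenPeriod t)) z, f)) atTop (𝓝 s'))
    (hz1 : ∀ k (f : Fin d) (z : Fin d → ℤ), ∃ s' : ℂ, Tendsto (fun t => zT L (cubic d (evenPeriod t)) (fun k'' ν' (x' : idx L (cubic d (evenPeriod t)) k'') => Complex.exp (Complex.I * ((A₀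
          t) k'' ν' x' : ℂ) / ((lev L k'' : ℕ) : ℂ))) k (castT (cubic d (lev L k * evenPeriod t)) z, f)) atTop (𝓝 s')) :
    ∃ P₁ P₂ P₁₂ : ℕ → B12Beta.Kernel d,
      (∀ k, IsInfiniteVolumeLimit evenPeriod
      (fun t μ' ν' (z : Site d (evenPeriod t)) =>
          ((deriv (fun r : ℝ => deriv (fun s : ℝ => (avgTow (QBlev L (cubic d (evenPeriod t))) ((L : ℝ) ^ d)
          (fun k' => (calDalev L (cubic d (evenPeriod t)) a ha k' + covPert L (cubic d (evenPeriod t)) (fun k'' ν' (x' : idx L (cubic d (evenPeriod t)) k'') => Complex.exp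
                (Complex.I * ((A₀ t) k'' ν' x' : ℂ) / ((lev L k'' : ℕ) : ℂ) + (Complex.I * ((A₁ t) k'' ν' x' : ℂ) / ((lev L k'' : ℕ) : ℂ)) * ((s : ℝ) : ℂ) + (Complex.I * ((B t) k'' ν' x' :
                      ℂ) / ((lev L k'' : ℕ) : ℂ)) * ((r : ℝ) :
                ℂ))) k')⁻¹) k)⁻¹) 0) 0)
            ((unitIdx L (cubic d (evenPeriod t))).symm (z, μ')) ((unitIdx L (cubic d (evenPeriod t))).symm (0, ν'))).re) (P₁ k)) ∧
      (∀ k, IsInfiniteVolumeLimit evenPeriod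
      (fun t μ' ν' (z : Site d (evenPeriod t)) =>
          ((deriv (fun r : ℝ => deriv (fun s : ℝ => (avgTow (QBlev L (cubic d (evenPeriod t))) ((L : ℝ) ^ d)
          (fun k' => (calDalev L (cubic d (evenPeriod t)) a ha k' + covPert L (cubic d (evenPeriod t)) (fun k'' ν' (x' : idx L (cubic d (evenPeriod t)) k'') => Complex.exp
                (Complex.I * ((A₀ t) k'' ν' x' : ℂ) / ((lev L k'' : ℕ) : ℂ) + (Complex.I * ((A₂ t) k'' ν' x' : ℂ) / ((lev L k'' : ℕ) : ℂ)) * ((s : ℝ) : ℂ) + (Complex.I * ((B t) k'' ν' x' :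
                      ℂ) / ((lev L k'' : ℕ) : ℂ)) * ((r : ℝ) :
                ℂ))) k')⁻¹) k)⁻¹) 0) 0)
            ((unitIdx L (cubic d (evenPeriod t))).symm (z, μ')) ((unitIdx L (cubic d (evenPeriod t))).symm (0, ν'))).re) (P₂ k)) ∧
      (∀ k, IsInfiniteVolumeLimit evenPeriod
      (fun t μ' ν' (z : Site d (evenPeriod t)) =>
          ((deriv (fun r : ℝ => deriv (fun s : ℝ => (avgTow (QBlev L (cubic d (evenPeriod t))) ((L : ℝ) ^ d)
          (fun k' => (calDalev L (cubic d (evenPeriod t)) a ha k' + covPert L (cubic d (evenPeriod t)) (fun k'' ν' (x' : idx L (cubic d (evenPeriod t)) k'') => Complex.exp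
                (Complex.I * ((A₀ t) k'' ν' x' : ℂ) / ((lev L k'' : ℕ) : ℂ) + (Complex.I * ((A₁ t k'' ν' x' + A₂ t k'' ν' x' : ℝ) : ℂ) / ((lev L k'' : ℕ) : ℂ)) * ((s : ℝ) : ℂ) + (Complex.I
                      * ((B t) k'' ν' x' : ℂ) / ((lev L k'' : ℕ) : ℂ)) * ((r : ℝ) :
                ℂ))) k')⁻¹) k)⁻¹) 0) 0)
            ((unitIdx L (cubic d (evenPeriod t))).symm (z, μ')) ((unitIdx L (cubic d (evenPeriod t))).symm (0, ν'))).re) (P₁₂ k)) ∧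
      (∀ k, B12Beta.secondMoment (P₁₂ k) μ ν = B12Beta.secondMoment (P₁ k) μ ν + B12Beta.secondMoment (P₂ k) μ ν) ∧
      B12Beta.secondMoment (limKernelOf P₁₂) μ ν = B12Beta.secondMoment (limKernelOf P₁) μ ν + B12Beta.secondMoment (limKernelOf P₂) μ ν := by
  have hα : 0 ≤ α := (hA₁ 0).nonneg.1
  have hβ : 0 ≤ β := (hA₁ 0).nonneg.2
  have hd1 : 1 ≤ d := le_trans (by norm_num) hd
  have hd0 : (0 : ℝ) < d := by exact_mod_cast (lt_of_lt_of_le (by norm_num) hd : 0 < d)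
  have hL1 : (1 : ℝ) < L := by exact_mod_cast (lt_of_lt_of_le one_lt_two hL : 1 < L)
  have hθ0 : 0 ≤ Real.sqrt ((L : ℝ)⁻¹) := Real.sqrt_nonneg _
  have hθ1 : Real.sqrt ((L : ℝ)⁻¹) < 1 := by
    rw [show (1 : ℝ) = Real.sqrt 1 from Real.sqrt_one.symm]
    exact Real.sqrt_lt_sqrt (inv_nonneg.mpr (Nat.cast_nonneg _)) (inv_lt_one_of_one_lt₀ hL1)
  -- invertibility at the base, every volume and level (PART 271 §0 on the disc)
  have h0 := fun t k => isUnit_det_calDalev_add_covPert_of_disc L (cubic d (evenPeriod t)) a ha hd1 (hw t) (hz t) hT₁ k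
  have hc0 := fun t k => isUnit_det_avgTow_pertInv_of_disc L (cubic d (evenPeriod t)) a ha hd1 (hw t) (hz t) hT₁ hT₃ k
  -- the sum direction: Lipschitz `(2α, 2β)`, EL₁
  have hA : ∀ t, LipschitzBackground L (cubic d (evenPeriod t)) (fun k ν' x => ((A₁ t k ν' x + A₂ t k ν' x : ℝ) : ℂ)) (α + α) (β + β) := fun t => by
    have e : (fun k ν' (x : idx L (cubic d (evenPeriod t)) k) => ((A₁ t k ν' x + A₂ t k ν' x : ℝ) : ℂ))
        = fun k ν' x => (A₁ t k ν' x : ℂ) + (A₂ t k ν' x : ℂ) := by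
      funext k ν' x
      push_cast
      rfl
    rw [e]
    exact lipschitzBackground_add L _ (hA₁ t) (hA₂ t)
  have hB' : ∀ t, LipschitzBackground L (cubic d (evenPeriod t)) (fun k ν' x => (B t k ν' x : ℂ)) (α + α) (β + β) := fun t =>
    lipschitzBackground_mono L _ (hB t) (by linarith) (by linarith)
  have hA1 : ∀ k (ν' f : Fin d) (z : Fin d → ℤ), ∃ s' : ℂ,
      Tendsto (fun t => ((A₁ t k ν' (castT (cubic d (lev L k * evenPeriod t)) z, f) + A₂ t k ν' (castT (cubic d (lev L k * evenPeriod t)) z, f) : ℝ) : ℂ)) atTop (𝓝 s') := by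
    intro k ν' f z
    obtain ⟨s₁, h₁⟩ := hA₁1 k ν' f z
    obtain ⟨s₂, h₂⟩ := hA₂1 k ν' f z
    exact ⟨s₁ + s₂, (h₁.add h₂).congr fun t => (Complex.ofReal_add _ _).symm⟩
  obtain ⟨κ₁, C₁, C₁', hκ₁, -, -, P₁, hI₁, hU₁, -, -, hr₁⟩ :=
    conv_deriv_deriv_invCov_expChartAt₂_of_tendsto L a ha hL hd hne ha' hκ0 hγ' hδ' hJA hT₁ hT₂ hT₃ hA₁ hB hw hz hA₁1 hB1 hw1 hz1
  obtain ⟨κ₂, C₂, C₂', hκ₂, -, -, P₂, hI₂, hU₂, -, -, hr₂⟩ :=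
    conv_deriv_deriv_invCov_expChartAt₂_of_tendsto L a ha hL hd hne ha' hκ0 hγ' hδ' hJA hT₁ hT₂ hT₃ hA₂ hB hw hz hA₂1 hB1 hw1 hz1
  obtain ⟨κ₁₂, C₁₂, C₁₂', hκ₁₂, -, -, P₁₂, hI₁₂, -, -, -, hr₁₂⟩ :=
    conv_deriv_deriv_invCov_expChartAt₂_of_tendsto L a ha hL hd hne ha' hκ0 hγ' hδ' hJA hT₁ hT₂ hT₃ hA hB' hw hz hA1 hB1 hw1 hz1
  have hadd := hessianAtMoments_add_left L a ha h0 hc0 hI₁ hI₂ hI₁₂ hU₁ (div_pos hκ₁ hd0) hU₂ (div_pos hκ₂ hd0)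
  exact ⟨P₁, P₂, P₁₂, hI₁, hI₂, hI₁₂, hadd.1, hadd.2 hθ0 hθ1 hr₁ hr₂ hr₁₂⟩

/-- `exists_hessianAtMoments_add_right_of_tendsto` — the same in the SECOND direction: limit kernels of PART 269's families of `(A, B₁)`, `(A, B₂)`, `(A, B₁ + B₂)` at `U₀` whose β-type
numbers add at every level and at the limit, displaying only `(α, β)` + EL₁ and the base constants on the disc (PART 272's `hessianAtMoments_add_right` over PART 269). [our proof] -/
theorem exists_hessianAtMoments_add_right_of_tendsto (hL : 2 ≤ L) (hd : 3 ≤ d) {μ ν : Fin d} (hne : μ ≠ ν) {α β α₀ β₀ α₀' β₀' a' κ : ℝ}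
    (ha' : 0 < a') (hκ0 : 0 < κ)
    (hγ' : Jfree d a' κ 1 < gammaPs d a') (hδ' : deltaK d a' κ 1 < sigma0 d a' ^ 2) (hJA : JA d a a' κ 1 < gamD d a)
    (hT₁ : 1 * (2 * (d * (α₀ + β₀) * Cst d a) + α₀' * Cst d a) ≤ 1 / 2)
    (hT₂ : 1 * (d * (α₀ * G2 d a (max (JA d a a' κ 1) 0) (gamD d a - max (JA d a a' κ 1) 0) κ)
      + d * (Real.exp |κ| * (α₀ * G2 d a (max (JA d a a' κ 1) 0) (gamD d a - max (JA d a a' κ 1) 0) κ + β₀ * (gamD d a - max (JA d a a' κ 1) 0)⁻¹))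
      + α₀' * (gamD d a - max (JA d a a' κ 1) 0)⁻¹) ≤ 1 / 2)
    (hT₃ : 4 * 1 * (2 * (d * (α₀ + β₀) * Cst d a) + α₀' * Cst d a) * Cst d a ≤ gammaB d a)
    {A₀ A B₁ B₂ : (t : ℕ) → (k : ℕ) → Fin d → (idx L (cubic d (evenPeriod t)) k → ℝ)}
    (hA : ∀ t, LipschitzBackground L (cubic d (evenPeriod t)) (fun k ν' x => (A t k ν' x : ℂ)) α β)
    (hB₁ : ∀ t, LipschitzBackground L (cubic d (evenPeriod t)) (fun k ν' x => (B₁ t k ν' x : ℂ)) α β)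
    (hB₂ : ∀ t, LipschitzBackground L (cubic d (evenPeriod t)) (fun k ν' x => (B₂ t k ν' x : ℂ)) α β)
    (hw : ∀ t, LipschitzBackground L (cubic d (evenPeriod t)) (connV L (cubic d (evenPeriod t)) (fun k'' ν' (x' : idx L (cubic d (evenPeriod t)) k'') => Complex.exp (Complex.I * ((A₀ t) k''
          ν' x' : ℂ) / ((lev L k'' : ℕ) : ℂ)))) α₀ β₀)
    (hz : ∀ t, BoundedBackground L (cubic d (evenPeriod t)) (zT L (cubic d (evenPeriod t)) (fun k'' ν' (x' : idx L (cubic d (evenPeriod t)) k'') => Complex.exp (Complex.I * ((A₀ t) k'' ν'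
          x' : ℂ) / ((lev L k'' : ℕ) : ℂ)))) α₀' β₀')
    (hA1 : ∀ k (ν' f : Fin d) (z : Fin d → ℤ), ∃ s' : ℂ, Tendsto (fun t => ((A t k ν' (castT (cubic d (lev L k * evenPeriod t)) z, f) : ℝ) : ℂ)) atTop (𝓝 s'))
    (hB₁1 : ∀ k (ν' f : Fin d) (z : Fin d → ℤ), ∃ s' : ℂ, Tendsto (fun t => ((B₁ t k ν' (castT (cubic d (lev L k * evenPeriod t)) z, f) : ℝ) : ℂ)) atTop (𝓝 s'))
    (hB₂1 : ∀ k (ν' f : Fin d) (z : Fin d → ℤ), ∃ s' : ℂ, Tendsto (fun t => ((B₂ t k ν' (castT (cubic d (lev L k * evenPeriod t)) z, f) : ℝ) : ℂ)) atTop (𝓝 s'))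
    (hw1 : ∀ k (ν' f : Fin d) (z : Fin d → ℤ), ∃ s' : ℂ, Tendsto (fun t => connV L (cubic d (evenPeriod t)) (fun k'' ν' (x' : idx L (cubic d (evenPeriod t)) k'') => Complex.exp (Complex.I *
          ((A₀ t) k'' ν' x' : ℂ) / ((lev L k'' : ℕ) : ℂ))) k ν' (castT (cubic d (lev L k * evenPeriod t)) z, f)) atTop (𝓝 s'))
    (hz1 : ∀ k (f : Fin d) (z : Fin d → ℤ), ∃ s' : ℂ, Tendsto (fun t => zT L (cubic d (evenPeriod t)) (fun k'' ν' (x' : idx L (cubic d (evenPeriod t)) k'') => Complex.exp (Complex.I * ((A₀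
          t) k'' ν' x' : ℂ) / ((lev L k'' : ℕ) : ℂ))) k (castT (cubic d (lev L k * evenPeriod t)) z, f)) atTop (𝓝 s')) :
    ∃ P₁ P₂ P₁₂ : ℕ → B12Beta.Kernel d,
      (∀ k, IsInfiniteVolumeLimit evenPeriod
      (fun t μ' ν' (z : Site d (evenPeriod t)) =>
          ((deriv (fun r : ℝ => deriv (fun s : ℝ => (avgTow (QBlev L (cubic d (evenPeriod t))) ((L : ℝ) ^ d)
          (fun k' => (calDalev L (cubic d (evenPeriod t)) a ha k' + covPert L (cubic d (evenPeriod t)) (fun k'' ν' (x' : idx L (cubic d (evenPeriod t)) k'') => Complex.exp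
                (Complex.I * ((A₀ t) k'' ν' x' : ℂ) / ((lev L k'' : ℕ) : ℂ) + (Complex.I * ((A t) k'' ν' x' : ℂ) / ((lev L k'' : ℕ) : ℂ)) * ((s : ℝ) : ℂ) + (Complex.I * ((B₁ t) k'' ν' x' :
                      ℂ) / ((lev L k'' : ℕ) : ℂ)) * ((r : ℝ) :
                ℂ))) k')⁻¹) k)⁻¹) 0) 0)
            ((unitIdx L (cubic d (evenPeriod t))).symm (z, μ')) ((unitIdx L (cubic d (evenPeriod t))).symm (0, ν'))).re) (P₁ k)) ∧
      (∀ k, IsInfiniteVolumeLimit evenPeriod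
      (fun t μ' ν' (z : Site d (evenPeriod t)) =>
          ((deriv (fun r : ℝ => deriv (fun s : ℝ => (avgTow (QBlev L (cubic d (evenPeriod t))) ((L : ℝ) ^ d)
          (fun k' => (calDalev L (cubic d (evenPeriod t)) a ha k' + covPert L (cubic d (evenPeriod t)) (fun k'' ν' (x' : idx L (cubic d (evenPeriod t)) k'') => Complex.exp
                (Complex.I * ((A₀ t) k'' ν' x' : ℂ) / ((lev L k'' : ℕ) : ℂ) + (Complex.I * ((A t) k'' ν' x' : ℂ) / ((lev L k'' : ℕ) : ℂ)) * ((s : ℝ) : ℂ) + (Complex.I * ((B₂ t) k'' ν' x' :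
                      ℂ) / ((lev L k'' : ℕ) : ℂ)) * ((r : ℝ) :
                ℂ))) k')⁻¹) k)⁻¹) 0) 0)
            ((unitIdx L (cubic d (evenPeriod t))).symm (z, μ')) ((unitIdx L (cubic d (evenPeriod t))).symm (0, ν'))).re) (P₂ k)) ∧
      (∀ k, IsInfiniteVolumeLimit evenPeriod
      (fun t μ' ν' (z : Site d (evenPeriod t)) =>
          ((deriv (fun r : ℝ => deriv (fun s : ℝ => (avgTow (QBlev L (cubic d (evenPeriod t))) ((L : ℝ) ^ d)
          (fun k' => (calDalev L (cubic d (evenPeriod t)) a ha k' + covPert L (cubic d (evenPeriod t)) (fun k'' ν' (x' : idx L (cubic d (evenPeriod t)) k'') => Complex.exp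
                (Complex.I * ((A₀ t) k'' ν' x' : ℂ) / ((lev L k'' : ℕ) : ℂ) + (Complex.I * ((A t) k'' ν' x' : ℂ) / ((lev L k'' : ℕ) : ℂ)) * ((s : ℝ) : ℂ) + (Complex.I * ((B₁ t k'' ν' x' +
                      B₂ t k'' ν' x' : ℝ) : ℂ) / ((lev L k'' : ℕ) : ℂ)) * ((r : ℝ) :
                ℂ))) k')⁻¹) k)⁻¹) 0) 0)
            ((unitIdx L (cubic d (evenPeriod t))).symm (z, μ')) ((unitIdx L (cubic d (evenPeriod t))).symm (0, ν'))).re) (P₁₂ k)) ∧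
      (∀ k, B12Beta.secondMoment (P₁₂ k) μ ν = B12Beta.secondMoment (P₁ k) μ ν + B12Beta.secondMoment (P₂ k) μ ν) ∧
      B12Beta.secondMoment (limKernelOf P₁₂) μ ν = B12Beta.secondMoment (limKernelOf P₁) μ ν + B12Beta.secondMoment (limKernelOf P₂) μ ν := by
  have hα : 0 ≤ α := (hA 0).nonneg.1
  have hβ : 0 ≤ β := (hA 0).nonneg.2
  have hd1 : 1 ≤ d := le_trans (by norm_num) hd
  have hd0 : (0 : ℝ) < d := by exact_mod_cast (lt_of_lt_of_le (by norm_num) hd : 0 < d)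
  have hL1 : (1 : ℝ) < L := by exact_mod_cast (lt_of_lt_of_le one_lt_two hL : 1 < L)
  have hθ0 : 0 ≤ Real.sqrt ((L : ℝ)⁻¹) := Real.sqrt_nonneg _
  have hθ1 : Real.sqrt ((L : ℝ)⁻¹) < 1 := by
    rw [show (1 : ℝ) = Real.sqrt 1 from Real.sqrt_one.symm]
    exact Real.sqrt_lt_sqrt (inv_nonneg.mpr (Nat.cast_nonneg _)) (inv_lt_one_of_one_lt₀ hL1)
  -- invertibility at the base, every volume and level (PART 271 §0 on the disc)
  have h0 := fun t k => isUnit_det_calDalev_add_covPert_of_disc L (cubic d (evenPeriod t)) a ha hd1 (hw t) (hz t) hT₁ k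
  have hc0 := fun t k => isUnit_det_avgTow_pertInv_of_disc L (cubic d (evenPeriod t)) a ha hd1 (hw t) (hz t) hT₁ hT₃ k
  -- the sum direction: Lipschitz `(2α, 2β)`, EL₁
  have hB : ∀ t, LipschitzBackground L (cubic d (evenPeriod t)) (fun k ν' x => ((B₁ t k ν' x + B₂ t k ν' x : ℝ) : ℂ)) (α + α) (β + β) := fun t => by
    have e : (fun k ν' (x : idx L (cubic d (evenPeriod t)) k) => ((B₁ t k ν' x + B₂ t k ν' x : ℝ) : ℂ))
        = fun k ν' x => (B₁ t k ν' x : ℂ) + (B₂ t k ν' x : ℂ) := by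
      funext k ν' x
      push_cast
      rfl
    rw [e]
    exact lipschitzBackground_add L _ (hB₁ t) (hB₂ t)
  have hA' : ∀ t, LipschitzBackground L (cubic d (evenPeriod t)) (fun k ν' x => (A t k ν' x : ℂ)) (α + α) (β + β) := fun t =>
    lipschitzBackground_mono L _ (hA t) (by linarith) (by linarith)
  have hB1 : ∀ k (ν' f : Fin d) (z : Fin d → ℤ), ∃ s' : ℂ,
      Tendsto (fun t => ((B₁ t k ν' (castT (cubic d (lev L k * evenPeriod t)) z, f) + B₂ t k ν' (castT (cubic d (lev L k * evenPeriod t)) z, f) : ℝ) : ℂ)) atTop (𝓝 s') := by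
    intro k ν' f z
    obtain ⟨s₁, h₁⟩ := hB₁1 k ν' f z
    obtain ⟨s₂, h₂⟩ := hB₂1 k ν' f z
    exact ⟨s₁ + s₂, (h₁.add h₂).congr fun t => (Complex.ofReal_add _ _).symm⟩
  obtain ⟨κ₁, C₁, C₁', hκ₁, -, -, P₁, hI₁, hU₁, -, -, hr₁⟩ :=
    conv_deriv_deriv_invCov_expChartAt₂_of_tendsto L a ha hL hd hne ha' hκ0 hγ' hδ' hJA hT₁ hT₂ hT₃ hA hB₁ hw hz hA1 hB₁1 hw1 hz1
  obtain ⟨κ₂, C₂, C₂', hκ₂, -, -, P₂, hI₂, hU₂, -, -, hr₂⟩ :=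
    conv_deriv_deriv_invCov_expChartAt₂_of_tendsto L a ha hL hd hne ha' hκ0 hγ' hδ' hJA hT₁ hT₂ hT₃ hA hB₂ hw hz hA1 hB₂1 hw1 hz1
  obtain ⟨κ₁₂, C₁₂, C₁₂', hκ₁₂, -, -, P₁₂, hI₁₂, -, -, -, hr₁₂⟩ :=
    conv_deriv_deriv_invCov_expChartAt₂_of_tendsto L a ha hL hd hne ha' hκ0 hγ' hδ' hJA hT₁ hT₂ hT₃ hA' hB hw hz hA1 hB1 hw1 hz1
  have hadd := hessianAtMoments_add_right L a ha h0 hc0 hI₁ hI₂ hI₁₂ hU₁ (div_pos hκ₁ hd0) hU₂ (div_pos hκ₂ hd0)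
  exact ⟨P₁, P₂, P₁₂, hI₁, hI₂, hI₁₂, hadd.1, hadd.2 hθ0 hθ1 hr₁ hr₂ hr₁₂⟩

end End

end Summit.QuantumFields.BalabanUV.Beta.GAN24.ExponentialChartBaseHessianMomentsEnd

end
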